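import Literature.MathematicalPhysics.QuantumFieldTheory.Balaban1983to89.B2Prop31MinimizerWitness

/-!
# `Balaban1983to89.B2Prop31MinimizerWitness2` — [Balaban1982Higgs2] Proposition 3.1 p. 589: a TWO-SCALE instance (`K = 2`) of the
corrected family `B2Prop31MinimizerFamilyK.RMultiMK` with BOTH small-field regions `Λ₁`, `Λ₂` non-empty, a genuine `θ₂`-slice
(p. 567: *"θ_k … is equal to 1 on Bᵏ⁻¹(Λ₂⁽ᵏ⁻¹⁾) and varies “smoothly” from 1 to 0 on a slice"*), the printed restrictions live at both
scales, and a NON-ZERO field — the multi-step companion of `B2Prop31MinimizerWitness` (its HONEST SCOPE (i))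

statement-level skeleton of published theorems with citation tags; proofs where landed; nothing here is a claim about the Yang–Mills mass gap

CITATION HEADER.  T. Bałaban, *(Higgs)₂,₃ quantum fields in a finite volume. II. An upper bound*, Commun. Math. Phys. **86**
(1982) 555–594 [Balaban1982Higgs2] (PDF held `paper:balaban1982-cmp86-higgs23-ii`, journal page = PDF page + 554; pp. 566–567, 570–571,
583, 588–589).  Cell `lit-balaban` (HOME `run/shared/lean/pub/lit-balaban/`), Phase-2 proof seat **p23** gen 12 (unit `lit-balaban-p23-g12`).
SKELETON rows **B2.Prop3.1** (owner r02), **B2.Eq3.29**, **B2.Eq2.44**; second reader r14, referee ref-4.  USED BY NAME, NOTHING RESTATED: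
`B2Prop31MinimizerFamilyK.RMultiMK` (p315587), `B2Prop31MinimizerWitness.{chargeW, thrQ_nonneg, thrA_pos, kappaW, kappaW_nonneg}` (p315976),
`B2Eq244Cutoff.{zeta244, zeta244_cutoff244, abs_zeta244_le_one, zeta244_supp, zeta244_lip, le_rFn}` (p315440), `B2Prop31MinimizerFamily.
{MinConsts, Lemma23Bounds, exists_lemma23Bounds, exp_neg_delta_rho_le}` (p314111), `B2Eq324NestedRegions.{Tower, prime}` (p15),
`B2Eq32FieldRegularity.field32_eq_top` (p23 g10), `B1Cor23ZeroFieldRegion.exists_weight` (the 1-Lipschitz distance weight to a set), r14's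
`B2Lemma23HiggsLattice.cutMin`, the typer's `HiggsLattice.blockSet`, `HiggsAveraging.{blockIter, blockK, toFinest}`, `B3MultiscaleFields`,
`B1Eq211ZeroFieldTorus.Shape`, b2b's `B2`, `B1.{aSeq, ainf_lt_aSeq}`, `PlateauMollifier.abs_clamp_sub_clamp_le`.

THE INSTANCE (§1–§2).  Torus `P` of the sub-family with `P.K ≥ 2`, `L²ε ≤ ε₀`; a block label `y₀ ∈ T⁽²⁾`.  Tower (`lam2`): `Λ₅⁽⁰⁾ = T_ε`,
`Λ₅⁽¹⁾ = B(y₀) ⊂ T⁽¹⁾` (a union of blocks), `Λ₅⁽²⁾ = ∅`; hence (3.23)–(3.24) `Λ₁ = T⁽¹⁾ ∖ B(y₀)` and `Λ₂ = (B(y₀))′ ∋ y₀` — both scales carry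
fields.  Cut-offs (`theta2`): `θ₁ ≡ 1`; `θ₂(z) = max(0, min(1, 1 + (c_θ/L)(1 − D(z))))` with `D = dist_{T_ε}(z, B²(y₀))` the 1-Lipschitz
distance weight (`exists_weight`) — equal to `1` on `B²(y₀)` and one fine step around it, falling to `0` at distance `1 + L/c_θ` with slope
`c_θ/L` per fine step (the printed *"varies smoothly … on a slice"*; for `c_θ = 0` it degenerates to `θ₂ ≡ 1`); `θ_m ≡ 0` for `m ≥ 3`.
`A₀ = 0`; block fields `A_k ≡ v`; `Φ = 0`; regions `Λ₁ = Λ₂ = T⁽ᵏ⁾`; (2.44) cut-offs `ζ^{(k)} := zeta244 k (r(Lᵏε))`, `k = 1, 2`.  Then the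
field (3.2) is `Ã^ε = (1 − θ₂)A^{(1),ε} + θ₂A^{(2),ε}` and equals `A^{(2),ε}` on `B²(y₀)` (`witness2_field_apply_core`).
`restrictedM` (§2): (2.55)₂ at BOTH scales `‖v‖ ≤ thrA(Lε)`, `‖v‖ ≤ thrA(L²ε)`; (2.55)₁ of a constant `= 0`; the (2.17) clause IS LIVE on the
`θ₂`-slice over `B¹(Λ₁)` and holds with `|v_μ − v_μ| = 0 ≤ thr217(Lε)`; `Φ = 0` meets (2.55)₄.  NON-ZERO FIELD (§3): Lemma 2.3 with `q = 0` at
level `2` (`norm_cutMin_const_sub_le_level`, the level-generic form of the sibling's `norm_cutMin_const_sub_le`): `‖A^{(2),ε}(x) − v‖ < ‖v‖`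
for `κ·L²ε < 1`, so `Ã^ε ≠ 0` at the corner of `B²(y₀)`.

WHAT THIS MODULE PROVES (kernel-checked, 0 `sorry`, standard axioms; definitions with bodies `lam2`, `tower2`, `distW`, `theta2`, `witness2`;
no `Prop` facts).  §1 `lam2`, `tower2`, `tower2_lam_zero/_one`, `blockK_two_nonempty`, `distW` (+ `distW_lip`, `distW_zero`, `distW_nonneg`,
`distW_shift_le_one`), `theta2` (+ `theta2_one`, `theta2_two`, `theta2_zero_idx`, `theta2_ge_three`, `theta2_range`, `nested_theta2`,
`theta2_two_eq_one`, `theta2_lip`), **`witness2`** (an `RMultiMK Q Γ m²` with `K = 2`); §2 `witness2_K`, `witness2_lam`, `witness2_field_apply_core`,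
`thr217M_nonneg`, **`witness2_restrictedM`**; §3 `norm_cutMin_const_sub_le_level`, `norm_cutMin_const_sub_lt_level` (Lemma 2.3 with `q = 0` at
any level `1 ≤ k ≤ K`), **`witness2_field_ne_zero`**, **`exists_two_scale_witness`**.
HONEST SCOPE.  (i) Two steps; the second small-field region is one block `B(y₀)` (any union of blocks would do the same way).  (ii) The block
fields are one constant `v` at both scales, so (2.17) holds with room to spare; a witness with `A_2 ≠ A_1` on the slice would need
`|v₂ − v₁| ≤ c₄(Lε)^{−(d−2)/2}p(Lε)`, equally easy, not done.  (iii) `θ₂`'s profile is the clamp, not `C^∞` (print asks only the lattice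
smoothness `|θ_{k+1}(z + εe_ν) − θ_{k+1}(z)| ≤ O(1)L^{−k}`, our `θ_lip`).  (iv) Constants as in the sibling (`R ≥ max(6, 2/δ)`, `L²ε ≤ s₁`).
(v) No row head changes are claimed (owner r02).  Nothing here is summit progress.
-/

noncomputable section

open Finset Real
open scoped BigOperators

namespace Literature.MathematicalPhysics.QuantumFieldTheory.Balaban1983to89.B2Prop31MinimizerWitness2

open Literature.MathematicalPhysics.QuantumFieldTheory.Balaban1983to89.HiggsLattice
open Literature.MathematicalPhysics.QuantumFieldTheory.Balaban1983to89.HiggsAveraging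
open Literature.MathematicalPhysics.QuantumFieldTheory.Balaban1983to89.B2Eq337ScalarIntegration
open Literature.MathematicalPhysics.QuantumFieldTheory.Balaban1983to89.B2Eq328ConcretePieces
open Literature.MathematicalPhysics.QuantumFieldTheory.Balaban1983to89.B2Prop31ZeroFieldConcrete
open Literature.MathematicalPhysics.QuantumFieldTheory.Balaban1983to89.B2Eq324NestedRegions
open Literature.MathematicalPhysics.QuantumFieldTheory.Balaban1983to89.B2Eq32FieldRegularity
open Literature.MathematicalPhysics.QuantumFieldTheory.Balaban1983to89.B2Prop31Thresholds
open Literature.MathematicalPhysics.QuantumFieldTheory.Balaban1983to89.B2Prop31PrintedRestrictions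
open Literature.MathematicalPhysics.QuantumFieldTheory.Balaban1983to89.B3MultiscaleFields (toSite ofSite zeroCharge toSite_ofSite)
open Literature.MathematicalPhysics.QuantumFieldTheory.Balaban1983to89.B2Lemma23HiggsLattice (cutMin)
open Literature.MathematicalPhysics.QuantumFieldTheory.Balaban1983to89.B1Eq211ZeroFieldTorus (Shape)
open Literature.MathematicalPhysics.QuantumFieldTheory.Balaban1983to89.B2Prop31MinimizerFamily
  (MinConsts Lemma23Bounds exists_lemma23Bounds exp_neg_delta_rho_le)
open Literature.MathematicalPhysics.QuantumFieldTheory.Balaban1983to89.B2Prop31MinimizerFamilyK (RMultiMK)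
open Literature.MathematicalPhysics.QuantumFieldTheory.Balaban1983to89.B2Eq244Cutoff
  (zeta244 zeta244_cutoff244 abs_zeta244_le_one zeta244_supp zeta244_lip le_rFn)
open Literature.MathematicalPhysics.QuantumFieldTheory.Balaban1983to89.B2Prop31MinimizerWitness
  (chargeW thrQ_nonneg thrA_pos kappaW kappaW_nonneg)
open Literature.MathematicalPhysics.QuantumFieldTheory.Balaban1983to89.B2Ineq329BlockPoincare (blockIter_toFinest)
open Literature.MathematicalPhysics.QuantumFieldTheory.Balaban1983to89.B1Ineq234LevelZero (tdist_shift_le_one)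
open Literature.MathematicalPhysics.QuantumFieldTheory.Balaban1983to89.B1Cor23ZeroFieldRegion (exists_weight)
open B2Sect2BDensities (Nested)

variable {P : HiggsLattice.Params}

/-! ## §1 The two-scale data: tower, cut-offs, the instance -/

/-- The tower of the instance: `Λ₅⁽⁰⁾ = T_ε`, `Λ₅⁽¹⁾ = B(y₀)` (the block of `y₀ ∈ T⁽²⁾`, a subset of `T⁽¹⁾`), `Λ₅⁽ᵐ⁾ = ∅` for `m ≥ 2`.
[cite: Balaban1982Higgs2, (3.23) p.588, (2.43) p.566] -/
def lam2 (y₀ : HiggsLattice.Site P 2) : (k : ℕ) → Finset (HiggsLattice.Site P k)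
  | 0 => Finset.univ
  | 1 => HiggsLattice.blockSet {y₀}
  | _ + 2 => ∅

/-- The two-step tower `Λ₅⁽⁰⁾ ⊃ B(Λ₅⁽¹⁾)`, `Λ₅⁽²⁾ = ∅` (p15's `Tower` hypotheses `top`/`isUnion`/`nested` discharged).
[cite: Balaban1982Higgs2, (3.23) p.588] -/
def tower2 (y₀ : HiggsLattice.Site P 2) : Tower P 2 where
  lam := lam2 y₀
  top := rfl
  isUnion := by
    intro k hk x x' hxx'
    match k, hk with
    | 0, _ => exact ⟨fun _ => Finset.mem_univ _, fun _ => Finset.mem_univ _⟩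
    | 1, _ =>
      show x ∈ HiggsLattice.blockSet {y₀} ↔ x' ∈ HiggsLattice.blockSet {y₀}
      rw [HiggsLattice.mem_blockSet, HiggsLattice.mem_blockSet, hxx']
  nested := by
    intro k hk x hx
    match k, hk with
    | 0, _ => exact Finset.mem_univ _
    | 1, _ => exact absurd hx (Finset.notMem_empty _)

/-- `Λ₅⁽⁰⁾ = T_ε`. [cite: Balaban1982Higgs2, (3.23) p.588] -/
theorem tower2_lam_zero (y₀ : HiggsLattice.Site P 2) : (tower2 y₀).lam 0 = Finset.univ := rfl

/-- `Λ₅⁽¹⁾ = B(y₀)`. [cite: Balaban1982Higgs2, (3.23) p.588] -/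
theorem tower2_lam_one (y₀ : HiggsLattice.Site P 2) : (tower2 y₀).lam 1 = HiggsLattice.blockSet {y₀} := rfl

/-- The iterated block `B²(y₀) ⊂ T_ε` is non-empty (`2 ≤ K`: it contains the corner `L²y₀`). [cite: Balaban1982Higgs1, (1.20) p.607] -/
theorem blockK_two_nonempty (hK2 : 2 ≤ P.K) (y₀ : HiggsLattice.Site P 2) : (blockK 2 y₀).Nonempty :=
  ⟨toFinest y₀, (mem_blockK 2 y₀ _).mpr (blockIter_toFinest hK2 y₀)⟩

/-- **The distance weight to `B²(y₀)`**: `D(z) = dist_{T_ε}(z, B²(y₀))` in fine lattice units — 1-Lipschitz for (1.3), `= 0` on the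
block, `≥ 0` (`B1Cor23ZeroFieldRegion.exists_weight`). [cite: Balaban1982Higgs1, (1.3) p.604, (1.20) p.607] -/
def distW (hK2 : 2 ≤ P.K) (y₀ : HiggsLattice.Site P 2) : HiggsLattice.Site P 0 → ℝ :=
  Classical.choose (exists_weight (blockK_two_nonempty hK2 y₀))

/-- `D` is 1-Lipschitz. [cite: Balaban1982Higgs1, (1.3) p.604] -/
theorem distW_lip (hK2 : 2 ≤ P.K) (y₀ : HiggsLattice.Site P 2) (x z : HiggsLattice.Site P 0) :
    |distW hK2 y₀ x - distW hK2 y₀ z| ≤ (HiggsLattice.Site.tdist x z : ℝ) :=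
  (Classical.choose_spec (exists_weight (blockK_two_nonempty hK2 y₀))).1 x z

/-- `D = 0` on `B²(y₀)`. [cite: Balaban1982Higgs1, (1.20) p.607] -/
theorem distW_zero (hK2 : 2 ≤ P.K) (y₀ : HiggsLattice.Site P 2) {z : HiggsLattice.Site P 0} (hz : blockIter 2 z = y₀) :
    distW hK2 y₀ z = 0 :=
  (Classical.choose_spec (exists_weight (blockK_two_nonempty hK2 y₀))).2.1 z ((mem_blockK 2 y₀ z).mpr hz)

/-- `D ≥ 0`. [cite: Balaban1982Higgs1, (1.3) p.604] -/
theorem distW_nonneg (hK2 : 2 ≤ P.K) (y₀ : HiggsLattice.Site P 2) (z : HiggsLattice.Site P 0) : 0 ≤ distW hK2 y₀ z :=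
  (Classical.choose_spec (exists_weight (blockK_two_nonempty hK2 y₀))).2.2.1 z

/-- One fine step off the block: `D(z + εe_ν) ≤ 1` for `z ∈ B²(y₀)`. [cite: Balaban1982Higgs1, (1.3) p.604] -/
theorem distW_shift_le_one (hK2 : 2 ≤ P.K) (y₀ : HiggsLattice.Site P 2) {z : HiggsLattice.Site P 0} (hz : blockIter 2 z = y₀)
    (ν : Fin P.d) : distW hK2 y₀ (z.shift ν) ≤ 1 := by
  have h1 := distW_lip hK2 y₀ (z.shift ν) z
  have h2 : (HiggsLattice.Site.tdist (z.shift ν) z : ℝ) ≤ 1 := by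
    rw [B1Ineq234LevelZero.tdist_comm]; exact_mod_cast tdist_shift_le_one z ν
  rw [distW_zero hK2 y₀ hz, sub_zero] at h1
  exact (le_abs_self _).trans (h1.trans h2)

/-- **The cut-offs of the instance**: `θ₁ ≡ 1`; `θ₂(z) = max(0, min(1, 1 + (c_θ/L)(1 − D(z))))` — `= 1` on `B²(y₀)` and one fine
step around it, slope `c_θ/L` per fine step (p. 567: *"equal to 1 on Bᵏ⁻¹(Λ₂⁽ᵏ⁻¹⁾) and varies “smoothly” from 1 to 0 on a slice"*);
`θ_m ≡ 0` otherwise. [cite: Balaban1982Higgs2, p.567, (3.2) p.583] -/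
def theta2 (cθ : ℝ) (D : HiggsLattice.Site P 0 → ℝ) : ℕ → HiggsLattice.Site P 0 → ℝ
  | 1, _ => 1
  | 2, z => max 0 (min 1 (1 + cθ / P.L * (1 - D z)))
  | _, _ => 0

variable (cθ : ℝ) (D : HiggsLattice.Site P 0 → ℝ)

/-- `θ₁ = 1`. [cite: Balaban1982Higgs2, p.567] -/
theorem theta2_one (z : HiggsLattice.Site P 0) : theta2 cθ D 1 z = 1 := rfl

/-- `θ₂ = the clamp profile`. [cite: Balaban1982Higgs2, p.567] -/
theorem theta2_two (z : HiggsLattice.Site P 0) : theta2 cθ D 2 z = max 0 (min 1 (1 + cθ / P.L * (1 - D z))) := rfl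

/-- `θ₀ = 0` (unused index). [cite: Balaban1982Higgs2, p.567] -/
theorem theta2_zero_idx (z : HiggsLattice.Site P 0) : theta2 cθ D 0 z = 0 := rfl

/-- `θ_m = 0` for `m ≥ 3`. [cite: Balaban1982Higgs2, p.567] -/
theorem theta2_ge_three (m : ℕ) (z : HiggsLattice.Site P 0) : theta2 cθ D (m + 3) z = 0 := rfl

/-- `0 ≤ θ_m ≤ 1`. [cite: Balaban1982Higgs2, p.567] -/
theorem theta2_range (m : ℕ) (z : HiggsLattice.Site P 0) : 0 ≤ theta2 cθ D m z ∧ theta2 cθ D m z ≤ 1 := by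
  match m with
  | 0 => rw [theta2_zero_idx]; norm_num
  | 1 => rw [theta2_one]; norm_num
  | 2 => rw [theta2_two]; exact ⟨le_max_left _ _, max_le zero_le_one (min_le_left _ _)⟩
  | m + 3 => rw [theta2_ge_three]; norm_num

/-- The cut-offs are nested: `θ_{j+1}θ_j = θ_{j+1}` (`θ₁ ≡ 1`; `θ_{j+1} = 0` for `j ≥ 2`). [cite: Balaban1982Higgs2, (2.51) p.569] -/
theorem nested_theta2 : Nested (theta2 (P := P) cθ D) := by
  intro j z hj
  match j, hj with
  | 1, _ => rw [theta2_one, mul_one]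
  | 2, _ =>
    show theta2 cθ D 3 z * theta2 cθ D 2 z = theta2 cθ D 3 z
    have h : theta2 cθ D 3 z = 0 := rfl
    rw [h, zero_mul]
  | j + 3, _ =>
    show theta2 cθ D (j + 4) z * theta2 cθ D (j + 3) z = theta2 cθ D (j + 4) z
    have h : theta2 cθ D (j + 4) z = 0 := rfl
    rw [h, zero_mul]

/-- `θ₂ = 1` where `D ≤ 1` (`c_θ ≥ 0`, `L > 0`): the plateau `B²(y₀)` and one fine step around it. [cite: Balaban1982Higgs2, p.567] -/
theorem theta2_two_eq_one (hcθ : 0 ≤ cθ) {z : HiggsLattice.Site P 0} (hz : D z ≤ 1) : theta2 cθ D 2 z = 1 := by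
  rw [theta2_two]
  have hL : (0 : ℝ) < P.L := by exact_mod_cast P.hL
  have h : 0 ≤ cθ / P.L * (1 - D z) := mul_nonneg (div_nonneg hcθ hL.le) (by linarith)
  rw [min_eq_left (by linarith), max_eq_right zero_le_one]

/-- **"varies smoothly"**: `|θ₂(z + εe_ν) − θ₂(z)| ≤ c_θ·L^{−1}` when `D` is 1-Lipschitz (`c_θ ≥ 0`). [cite: Balaban1982Higgs2, p.567] -/
theorem theta2_lip (hcθ : 0 ≤ cθ) (hD : ∀ x z, |D x - D z| ≤ (HiggsLattice.Site.tdist x z : ℝ)) (z : HiggsLattice.Site P 0)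
    (ν : Fin P.d) : |theta2 cθ D 2 (z.shift ν) - theta2 cθ D 2 z| ≤ cθ * ((P.L : ℝ) ^ 1)⁻¹ := by
  rw [theta2_two, theta2_two, pow_one]
  have hL : (0 : ℝ) < P.L := by exact_mod_cast P.hL
  refine (Literature.NumberTheory.LFunctions.PlateauMollifier.abs_clamp_sub_clamp_le _ _).trans ?_
  have h : 1 + cθ / P.L * (1 - D (z.shift ν)) - (1 + cθ / P.L * (1 - D z)) = cθ / P.L * (D z - D (z.shift ν)) := by ring
  rw [h, abs_mul, abs_of_nonneg (div_nonneg hcθ hL.le), div_eq_mul_inv]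
  refine mul_le_of_le_one_right (mul_nonneg hcθ (inv_nonneg.2 hL.le)) ?_
  have h1 := hD z (z.shift ν)
  have h2 : (HiggsLattice.Site.tdist z (z.shift ν) : ℝ) ≤ 1 := by exact_mod_cast tdist_shift_le_one z ν
  exact h1.trans h2

variable {Q : B2.Params} {Γ : MinConsts} {m2 : ℝ}

/-- **THE TWO-SCALE WITNESS** of the corrected family on a torus `P` of the sub-family (`P.L = Q.L`, `P.d = Q.d`, `P.K ≥ 2`, `L²ε ≤ ε₀`),
for `R ≥ 6`, `r ≥ 0`, valid `Γ`, a block label `y₀ ∈ T⁽²⁾` and a constant block-field value `v`: `K = 2`, tower `tower2 y₀`, cut-offs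
`theta2 Γ.cθ (distW y₀)`, `A₀ = 0`, `A_k ≡ v`, `Φ = 0`, regions `Λ₁ = Λ₂ = T⁽ᵏ⁾`, (2.44) cut-offs `zeta244 k (r(Lᵏε))`.
[cite: Balaban1982Higgs2, Prop. 3.1 p.589, (3.2)–(3.3) p.583, (2.44) p.566, p.567, (3.23) p.588] -/
def witness2 (hΓ : Γ.Valid) (hR : 6 ≤ Q.R) (hr : 0 ≤ Q.r) (P : HiggsLattice.Params) (S : Shape P) (hPL : P.L = Q.L)
    (hPd : P.d = Q.d) (hK2 : 2 ≤ P.K) (hε₀ : P.mesh 2 ≤ Γ.ε₀) (y₀ : HiggsLattice.Site P 2) (v : EuclideanSpace ℝ (Fin P.d)) :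
    RMultiMK Q Γ m2 where
  P := P
  hL := hPL
  hd := hPd
  S := S
  N := 1
  K := 2
  hK := hK2
  hε₀ := hε₀
  T := tower2 y₀
  C := chargeW Γ.e
  hCe := rfl
  θ := theta2 Γ.cθ (distW hK2 y₀)
  θ_nested := nested_theta2 _ _
  θ_range m z := theta2_range _ _ m z
  θ_one k hk1 hk2 z hz := by
    match k, hk1, hk2 with
    | 1, _, _ => exact ⟨theta2_one _ _ z, fun ν => theta2_one _ _ _⟩
    | 2, _, _ =>
      -- `lamAt 1 z`: the `1`-block label of `z` lies in `B(y₀)`, i.e. `z ∈ B²(y₀)`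
      have hz' : blockIter 2 z = y₀ := by
        have h : blockIter 1 z ∈ HiggsLattice.blockSet {y₀} := hz
        rw [HiggsLattice.mem_blockSet, Finset.mem_singleton] at h
        exact h
      exact ⟨theta2_two_eq_one _ _ hΓ.cθ_nonneg (by rw [distW_zero hK2 y₀ hz']; norm_num),
        fun ν => theta2_two_eq_one _ _ hΓ.cθ_nonneg (distW_shift_le_one hK2 y₀ hz' ν)⟩
  θ_zero k hk z _ := by
    have hk0 : k = 0 := by omega
    subst hk0
    exact Finset.mem_univ _
  θ_above m hm z := by
    obtain ⟨j, rfl⟩ : ∃ j, m = j + 3 := ⟨m - 3, by omega⟩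
    exact theta2_ge_three _ _ j z
  θ_lip k z ν := by
    match k with
    | 0 =>
      rw [theta2_one, theta2_one, sub_self, abs_zero]
      exact mul_nonneg hΓ.cθ_nonneg (inv_nonneg.2 (pow_nonneg (Nat.cast_nonneg _) _))
    | 1 => exact theta2_lip _ _ hΓ.cθ_nonneg (distW_lip hK2 y₀) z ν
    | k + 2 =>
      show |theta2 Γ.cθ (distW hK2 y₀) (k + 3) (z.shift ν) - theta2 Γ.cθ (distW hK2 y₀) (k + 3) z| ≤ _
      rw [theta2_ge_three, theta2_ge_three, sub_self, abs_zero]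
      exact mul_nonneg hΓ.cθ_nonneg (inv_nonneg.2 (pow_nonneg (Nat.cast_nonneg _) _))
  A₀ := 0
  Ac k := ofSite (fun _ : HiggsLattice.Site P k => v)
  Φ := 0
  ζ k := zeta244 P k (B2.rFn Q.R Q.r (P.mesh k))
  ζ_abs k _ _ x y' := abs_zeta244_le_one _ x y'
  ζ_supp k _ hk x y' h := zeta244_supp (hk.trans hK2) h
  ζ_one k _ hk x y' h := by
    have hs1 : P.mesh k ≤ 1 := (mesh_le_mesh hk).trans (hε₀.trans hΓ.ε₀_le_one)
    exact (zeta244_cutoff244 (hk.trans hK2) hR hr hs1).2.2.1 x y' h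
  ζ_lip k _ _ x ν y' := zeta244_lip _ x ν y'
  L1 _ := Finset.univ
  L2 _ := Finset.univ
  L2_sub _ := Finset.Subset.refl _
  nbhd _ _ y' _ _ := Finset.mem_univ y'
  lam_sub j _ := Finset.subset_univ _
  slice_sub j z ν _ := Finset.mem_univ _

/-! ## §2 Elementary properties and the printed restrictions at both scales -/

section Props

variable (hΓ : Γ.Valid) (hR : 6 ≤ Q.R) (hr : 0 ≤ Q.r) (P : HiggsLattice.Params) (S : Shape P) (hPL : P.L = Q.L)
  (hPd : P.d = Q.d) (hK2 : 2 ≤ P.K) (hε₀ : P.mesh 2 ≤ Γ.ε₀) (y₀ : HiggsLattice.Site P 2) (v : EuclideanSpace ℝ (Fin P.d))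

/-- Two steps. [cite: Balaban1982Higgs2, Prop. 3.1 p.589] -/
theorem witness2_K : (witness2 (m2 := m2) hΓ hR hr P S hPL hPd hK2 hε₀ y₀ v).K = 2 := rfl

/-- `Λ₅⁽⁰⁾ = T_ε` and `Λ₅⁽¹⁾ = B(y₀)` (both small-field regions `Λ₁ = T⁽¹⁾ ∖ B(y₀)`, `Λ₂ = B(y₀)′` carry fields).
[cite: Balaban1982Higgs2, (3.23) p.588] -/
theorem witness2_lam : (witness2 (m2 := m2) hΓ hR hr P S hPL hPd hK2 hε₀ y₀ v).T.lam 0 = Finset.univ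
    ∧ (witness2 (m2 := m2) hΓ hR hr P S hPL hPd hK2 hε₀ y₀ v).T.lam 1 = HiggsLattice.blockSet {y₀} := ⟨rfl, rfl⟩

/-- **On the core `B²(y₀)` the field IS the level-2 minimizer**: `Ã^ε(⟨z, z + εe_μ⟩) = A^{(2),ε}(z)_μ` for `z ∈ B²(y₀)` (`θ₂(z) = 1`,
gen 10's `field32_eq_top`). [cite: Balaban1982Higgs2, (3.2)–(3.3) p.583] -/
theorem witness2_field_apply_core (b : HiggsLattice.PBond P 0) (hb : blockIter 2 b.src = y₀) :
    (witness2 (m2 := m2) hΓ hR hr P S hPL hPd hK2 hε₀ y₀ v).field b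
      = cutMin (zeroCharge P.d) Γ.μ0sq Q.a 2 (zeta244 P 2 (B2.rFn Q.R Q.r (P.mesh 2))) (fun _ => v) b.src b.dir := by
  have h1 : theta2 Γ.cθ (distW hK2 y₀) 2 b.src = 1 :=
    theta2_two_eq_one _ _ hΓ.cθ_nonneg (by rw [distW_zero hK2 y₀ hb]; norm_num)
  show field32 (theta2 Γ.cθ (distW hK2 y₀)) 0 (witness2 (m2 := m2) hΓ hR hr P S hPL hPd hK2 hε₀ y₀ v).A 2 b = _
  rw [field32_eq_top (theta2 Γ.cθ (distW hK2 y₀)) 0 _ (nested_theta2 _ _) (by norm_num) b h1]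
  show ofSite (cutMin (zeroCharge P.d) Γ.μ0sq Q.a 2 (zeta244 P 2 (B2.rFn Q.R Q.r (P.mesh 2)))
    (toSite (ofSite fun _ : HiggsLattice.Site P 2 => v))) b = _
  rw [toSite_ofSite]
  rfl

/-- `thr217M(s) ≥ 0` for `0 < s ≤ 1`. [cite: Balaban1982Higgs2, (2.17) p.560] -/
theorem thr217M_nonneg {Γ : MinConsts} (hΓ : Γ.Valid) {s : ℝ} (hs : 0 < s) (hs1 : s ≤ 1) (d : ℕ) : 0 ≤ Γ.thr217M d s := by
  unfold MinConsts.thr217M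
  have hp : 0 ≤ B2.pFn Γ.b₀ Γ.p s := pFn_nonneg' (Γ := Γ.toConsts 0 0) (MinConsts.toConsts_valid hΓ le_rfl le_rfl) hs hs1
  have := hΓ.c₄_nonneg
  have : 0 ≤ s ^ (-((d : ℝ) - 2) / 2) := Real.rpow_nonneg hs.le _
  positivity

/-- **THE TWO-SCALE WITNESS IS RESTRICTED** when the constant block field obeys (2.55)₂ at both scales (`‖v‖ ≤ thrA(Lε)`,
`‖v‖ ≤ thrA(L²ε)`): (2.55)₁ of a constant is `0`; the (2.17) clause on the `θ₂`-slice over `B¹(Λ₁)` reads `|v_μ − v_μ| = 0 ≤ thr217(Lε)`;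
`Φ = 0`. [cite: Balaban1982Higgs2, Prop. 3.1 p.589, (2.55) p.570, (2.17) p.560, (3.15) p.586] -/
theorem witness2_restrictedM (hv1 : ‖v‖ ≤ Γ.thrA P.d (P.mesh 1)) (hv2 : ‖v‖ ≤ Γ.thrA P.d (P.mesh 2)) :
    (witness2 (m2 := m2) hΓ hR hr P S hPL hPd hK2 hε₀ y₀ v).restrictedM := by
  have hs2 : P.mesh 2 ≤ 1 := hε₀.trans hΓ.ε₀_le_one
  have hsk : ∀ {k : ℕ}, k ≤ 2 → 0 < P.mesh k ∧ P.mesh k ≤ 1 := fun hk => ⟨P.mesh_pos _, (mesh_le_mesh hk).trans hs2⟩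
  refine ⟨?_, ?_, ?_, ?_⟩
  · intro k hk1 hk y' _
    change k ≤ 2 at hk
    show ‖toSite (ofSite fun _ : HiggsLattice.Site P k => v) y'‖ ≤ Γ.thrA P.d (P.mesh k)
    rw [toSite_ofSite]
    interval_cases k
    · exact hv1
    · exact hv2
  · intro k hk1 hk y _ y' _
    change k ≤ 2 at hk
    show ‖toSite (ofSite fun _ : HiggsLattice.Site P k => v) y' - toSite (ofSite fun _ : HiggsLattice.Site P k => v) y‖
      ≤ Γ.thrQ P.d (P.mesh k) * (Γ.r₁ + Γ.r₂ * (HiggsLattice.Site.tdist y y' : ℝ))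
    rw [toSite_ofSite, sub_self, norm_zero]
    have h1 := thrQ_nonneg hΓ (hsk hk).1 (hsk hk).2 P.d
    have h2 := hΓ.r₁_nonneg
    have h3 := hΓ.r₂_nonneg
    positivity
  · intro j z _ μ ν _
    have hj : j.val + 1 ≤ 2 := by have h := j.isLt; change j.val < 2 at h; omega
    show |v μ - v μ| ≤ Γ.thr217M P.d (P.mesh (j.val + 1))
    rw [sub_self, abs_zero]
    exact thr217M_nonneg hΓ (hsk hj).1 (hsk hj).2 P.d
  · intro j y
    show ‖(0 : V 1)‖ ≤ _
    rw [norm_zero]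
    have hj : j.val + 1 ≤ 2 := by have h := j.isLt; change j.val < 2 at h; omega
    unfold MinConsts.thrφM
    have hp : 0 ≤ B2.pFn Γ.b₀ Γ.p (P.mesh (j.val + 1)) :=
      pFn_nonneg' (Γ := Γ.toConsts 0 0) (MinConsts.toConsts_valid hΓ le_rfl le_rfl) (hsk hj).1 (hsk hj).2
    have := hΓ.cφ_nonneg
    have : 0 ≤ Γ.lam ^ (-(1 / 4 : ℝ)) := Real.rpow_nonneg hΓ.lam_pos.le _
    have : 0 ≤ P.mesh (j.val + 1) ^ (-(P.d : ℝ) / 4) := Real.rpow_nonneg (hsk hj).1.le _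
    positivity

end Props

/-! ## §3 The field is not zero on the core: Lemma 2.3 with `q = 0` at a general level -/

section NonZero

/-- **LEMMA 2.3 (2.59) FOR A CONSTANT BLOCK FIELD AT LEVEL `k`** (`1 ≤ k ≤ K`, `Lᵏε ≤ min(ε₀, 1)`; the level-generic form of the sibling's
`B2Prop31MinimizerWitness.norm_cutMin_const_sub_le`): `‖A^{(k),ε}(x) − v‖ ≤ (C₂·Lᵏε + μ₀²(Lᵏε)²/(a_k + μ₀²(Lᵏε)²))·‖v‖`.
[cite: Balaban1982Higgs2, Lemma 2.3 (2.59) p.571, (2.62)–(2.63) p.571, (2.44) p.566, (2.7) p.558] -/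
theorem norm_cutMin_const_sub_le_level {d L : ℕ} {a μ0sq ε₀ δ C₁ C₂ : ℝ}
    (pkg : Lemma23Bounds d L a μ0sq ε₀ δ C₁ C₂) (hδ : 0 < δ) (hC₂ : 0 ≤ C₂)
    {P : HiggsLattice.Params} (S : Shape P) (hPd : P.d = d) (hPL : P.L = L) {k : ℕ} (hk1 : 1 ≤ k) (hk : k ≤ P.K)
    (hsε : P.mesh k ≤ ε₀) (hs1 : P.mesh k ≤ 1) {R r : ℝ} (hR6 : 6 ≤ R) (hRδ : 2 / δ ≤ R) (hr : 1 ≤ r)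
    (v : EuclideanSpace ℝ (Fin P.d)) (x : HiggsLattice.Site P 0) :
    ‖cutMin (zeroCharge P.d) μ0sq a k (zeta244 P k (B2.rFn R r (P.mesh k))) (fun _ => v) x - v‖
      ≤ (C₂ * P.mesh k + μ0sq * P.mesh k ^ 2 / (B1.aSeq a P.L k + μ0sq * P.mesh k ^ 2)) * ‖v‖ := by
  subst hPd hPL
  obtain ⟨habs, hsupp, hone, hlip⟩ := zeta244_cutoff244 (P := P) hk hR6 (by linarith) hs1
  have hρ₁ : 0 ≤ B2.rFn R r (P.mesh k) / 2 := by
    have h := le_rFn (by linarith : (0 : ℝ) ≤ R) (by linarith : (0 : ℝ) ≤ r) (P.mesh_pos k) hs1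
    linarith
  obtain ⟨h59, -⟩ := pkg P S rfl rfl (zeroCharge P.d) hk1 hk hsε _ _ _ hρ₁ habs hsupp hone hlip
    Finset.univ Finset.univ (Finset.Subset.refl _) (fun _ y' _ _ => Finset.mem_univ y') (fun _ => v) ‖v‖ 0 0 0
    le_rfl le_rfl le_rfl (fun y' _ => le_rfl) (fun y _ y' _ => by simp) x (Finset.mem_univ _)
  have hE : Real.exp (-(δ * (B2.rFn R r (P.mesh k) / 2))) ≤ P.mesh k := exp_neg_delta_rho_le (P.mesh_pos k) hs1 hδ hRδ hr
  have hv : 0 ≤ ‖v‖ := norm_nonneg v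
  calc ‖cutMin (zeroCharge P.d) μ0sq a k (zeta244 P k (B2.rFn R r (P.mesh k))) (fun _ => v) x - v‖
      ≤ C₁ * (0 + 0) * 0 + C₂ * Real.exp (-(δ * (B2.rFn R r (P.mesh k) / 2))) * ‖v‖
          + μ0sq * P.mesh k ^ 2 / (B1.aSeq a P.L k + μ0sq * P.mesh k ^ 2) * ‖v‖ := h59
    _ = C₂ * Real.exp (-(δ * (B2.rFn R r (P.mesh k) / 2))) * ‖v‖
          + μ0sq * P.mesh k ^ 2 / (B1.aSeq a P.L k + μ0sq * P.mesh k ^ 2) * ‖v‖ := by ring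
    _ ≤ C₂ * P.mesh k * ‖v‖ + μ0sq * P.mesh k ^ 2 / (B1.aSeq a P.L k + μ0sq * P.mesh k ^ 2) * ‖v‖ := by gcongr
    _ = (C₂ * P.mesh k + μ0sq * P.mesh k ^ 2 / (B1.aSeq a P.L k + μ0sq * P.mesh k ^ 2)) * ‖v‖ := by ring

/-- **`‖A^{(k),ε}(x) − v‖ < ‖v‖` at level `k` for `v ≠ 0` and `κ·Lᵏε < 1`** (`κ = C₂ + μ₀²/a_∞`; level-generic form of the sibling's
`norm_cutMin_const_sub_lt`). [cite: Balaban1982Higgs2, Lemma 2.3 (2.59) p.571, (3.3) p.583] -/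
theorem norm_cutMin_const_sub_lt_level {d L : ℕ} {a μ0sq ε₀ δ C₁ C₂ : ℝ} (ha : 0 < a) (hμ : 0 < μ0sq)
    (pkg : Lemma23Bounds d L a μ0sq ε₀ δ C₁ C₂) (hδ : 0 < δ) (hC₂ : 0 ≤ C₂)
    {P : HiggsLattice.Params} (S : Shape P) (hPd : P.d = d) (hPL : P.L = L) {k : ℕ} (hk1 : 1 ≤ k) (hk : k ≤ P.K)
    (hsε : P.mesh k ≤ ε₀) (hs1 : P.mesh k ≤ 1) {R r : ℝ} (hR6 : 6 ≤ R) (hRδ : 2 / δ ≤ R) (hr : 1 ≤ r)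
    (hsmall : kappaW a L μ0sq C₂ * P.mesh k < 1) {v : EuclideanSpace ℝ (Fin P.d)} (hv : v ≠ 0) (x : HiggsLattice.Site P 0) :
    ‖cutMin (zeroCharge P.d) μ0sq a k (zeta244 P k (B2.rFn R r (P.mesh k))) (fun _ => v) x - v‖ < ‖v‖ := by
  have h := norm_cutMin_const_sub_le_level pkg hδ hC₂ S hPd hPL hk1 hk hsε hs1 hR6 hRδ hr v x
  subst hPL
  have hLr : (1 : ℝ) < P.L := by exact_mod_cast S.hL.2
  set s : ℝ := P.mesh k with hs_def
  have hs : 0 < s := P.mesh_pos k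
  have hainf : 0 < a * (1 - ((P.L : ℝ) ^ 2)⁻¹) := by
    have hL2 : 1 < (P.L : ℝ) ^ 2 := by nlinarith
    have : ((P.L : ℝ) ^ 2)⁻¹ < 1 := inv_lt_one_of_one_lt₀ hL2
    exact mul_pos ha (by linarith)
  have hak : a * (1 - ((P.L : ℝ) ^ 2)⁻¹) < B1.aSeq a P.L k := B1.ainf_lt_aSeq ha hLr k hk1
  have hfrac : μ0sq * s ^ 2 / (B1.aSeq a P.L k + μ0sq * s ^ 2) ≤ μ0sq / (a * (1 - ((P.L : ℝ) ^ 2)⁻¹)) * s := by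
    have hden : a * (1 - ((P.L : ℝ) ^ 2)⁻¹) ≤ B1.aSeq a P.L k + μ0sq * s ^ 2 := by nlinarith [sq_nonneg s]
    calc μ0sq * s ^ 2 / (B1.aSeq a P.L k + μ0sq * s ^ 2)
        ≤ μ0sq * s ^ 2 / (a * (1 - ((P.L : ℝ) ^ 2)⁻¹)) := div_le_div_of_nonneg_left (by positivity) hainf hden
      _ = μ0sq / (a * (1 - ((P.L : ℝ) ^ 2)⁻¹)) * (s * s) := by rw [sq]; ring
      _ ≤ μ0sq / (a * (1 - ((P.L : ℝ) ^ 2)⁻¹)) * (s * 1) := by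
          apply mul_le_mul_of_nonneg_left _ (div_nonneg hμ.le hainf.le)
          exact mul_le_mul_of_nonneg_left hs1 hs.le
      _ = μ0sq / (a * (1 - ((P.L : ℝ) ^ 2)⁻¹)) * s := by rw [mul_one]
  have hrate : C₂ * s + μ0sq * s ^ 2 / (B1.aSeq a P.L k + μ0sq * s ^ 2) ≤ kappaW a P.L μ0sq C₂ * s := by
    unfold kappaW
    rw [add_mul]
    linarith
  have hvpos : 0 < ‖v‖ := norm_pos_iff.mpr hv
  calc ‖cutMin (zeroCharge P.d) μ0sq a k (zeta244 P k (B2.rFn R r s)) (fun _ => v) x - v‖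
      ≤ (C₂ * s + μ0sq * s ^ 2 / (B1.aSeq a P.L k + μ0sq * s ^ 2)) * ‖v‖ := h
    _ ≤ kappaW a P.L μ0sq C₂ * s * ‖v‖ := mul_le_mul_of_nonneg_right hrate hvpos.le
    _ < 1 * ‖v‖ := mul_lt_mul_of_pos_right hsmall hvpos
    _ = ‖v‖ := one_mul _

variable {Q : B2.Params} {Γ : MinConsts} {m2 : ℝ}

/-- **THE FIELD OF THE TWO-SCALE WITNESS IS NOT ZERO** (`v ≠ 0`, `R ≥ max(6, 2/δ)`, `r ≥ 1`, `κ·L²ε < 1`): at the corner `z₀ = L²y₀` of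
`B²(y₀)`, `Ã^ε(⟨z₀, μ⟩) = A^{(2),ε}(z₀)_μ` and `A^{(2),ε}(z₀) ≠ 0`. [cite: Balaban1982Higgs2, Prop. 3.1 p.589, (3.2)–(3.3) p.583, Lemma 2.3 p.571] -/
theorem witness2_field_ne_zero (hΓ : Γ.Valid) (hQa : 0 < Q.a) {δ C₁ C₂ : ℝ}
    (pkg : Lemma23Bounds Q.d Q.L Q.a Γ.μ0sq Γ.ε₀ δ C₁ C₂) (hδ : 0 < δ) (hC₂ : 0 ≤ C₂)
    (hR : 6 ≤ Q.R) (hRδ : 2 / δ ≤ Q.R) (hr : 1 ≤ Q.r) (P : HiggsLattice.Params) (S : Shape P) (hPL : P.L = Q.L)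
    (hPd : P.d = Q.d) (hK2 : 2 ≤ P.K) (hε₀ : P.mesh 2 ≤ Γ.ε₀) (hsmall : kappaW Q.a Q.L Γ.μ0sq C₂ * P.mesh 2 < 1)
    (y₀ : HiggsLattice.Site P 2) {v : EuclideanSpace ℝ (Fin P.d)} (hv : v ≠ 0) :
    (witness2 (m2 := m2) hΓ hR (by linarith) P S hPL hPd hK2 hε₀ y₀ v).field ≠ 0 := by
  intro h0
  have hs1 : P.mesh 2 ≤ 1 := hε₀.trans hΓ.ε₀_le_one
  set x : HiggsLattice.Site P 0 := toFinest y₀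
  have hx : blockIter 2 x = y₀ := blockIter_toFinest hK2 y₀
  have hlt := norm_cutMin_const_sub_lt_level hQa hΓ.μ0sq_pos pkg hδ hC₂ S hPd hPL (by norm_num) hK2 hε₀ hs1 hR hRδ hr
    hsmall hv x
  have hne : cutMin (zeroCharge P.d) Γ.μ0sq Q.a 2 (zeta244 P 2 (B2.rFn Q.R Q.r (P.mesh 2))) (fun _ => v) x ≠ 0 := by
    intro hz
    rw [hz, zero_sub, norm_neg] at hlt
    exact lt_irrefl _ hlt
  apply hne
  ext μ
  -- the bond `⟨x, μ⟩` is typed over `P` (not over the definitionally equal `(witness2 …).P`) so that (3.2) on the core applies verbatim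
  have hb := (witness2_field_apply_core (m2 := m2) hΓ hR (le_trans zero_le_one hr) P S hPL hPd hK2 hε₀ y₀ v ⟨x, μ⟩ hx).symm.trans
    (congrFun h0 (⟨x, μ⟩ : HiggsLattice.PBond P 0))
  exact hb

/-- **TWO-SCALE NON-VACUITY WITH A NON-ZERO FIELD, ON EVERY TORUS WITH A FINE ENOUGH LATTICE.**  For `d ≥ 1`, odd `L > 1`, `a > 0` and a
valid `Γ` there are `R₁ > 0` and `0 < s₁ ≤ ε₀` such that for every `Q` (`Q.d = d`, `Q.L = L`, `Q.a = a`, `Q.R ≥ R₁`, `Q.r ≥ 1`), every `m²`,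
every torus `P` of the sub-family with `P.d = d`, `P.L = L`, `P.K ≥ 2`, `L²ε ≤ s₁`, every block label `y₀ ∈ T⁽²⁾` and every `v ≠ 0` with
`‖v‖ ≤ thrA(Lε)` and `‖v‖ ≤ thrA(L²ε)`, there is `i : RMultiMK Q Γ m²` on `P` with `i.K = 2`, `Λ₅⁽⁰⁾ = T_ε`, `Λ₅⁽¹⁾ = B(y₀)`, `i.restrictedM`
and `i.field ≠ 0`. [cite: Balaban1982Higgs2, Prop. 3.1 p.589, (3.3) p.583, (2.44) p.566, (2.55) p.570, Lemma 2.3 p.571, (3.23) p.588] -/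
theorem exists_two_scale_witness (d L : ℕ) (hd : 1 ≤ d) (hL : Odd L ∧ 1 < L) {a : ℝ} (ha : 0 < a)
    (Γ : MinConsts) (hΓ : Γ.Valid) :
    ∃ R₁ s₁ : ℝ, 0 < R₁ ∧ 0 < s₁ ∧ s₁ ≤ Γ.ε₀ ∧
      ∀ (Q : B2.Params), Q.d = d → Q.L = L → Q.a = a → R₁ ≤ Q.R → 1 ≤ Q.r → ∀ (m2 : ℝ)
        (P : HiggsLattice.Params) (_S : Shape P), P.d = d → P.L = L → 2 ≤ P.K → P.mesh 2 ≤ s₁ →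
        ∀ (y₀ : HiggsLattice.Site P 2) (v : EuclideanSpace ℝ (Fin P.d)),
          ‖v‖ ≤ Γ.thrA P.d (P.mesh 1) → ‖v‖ ≤ Γ.thrA P.d (P.mesh 2) → v ≠ 0 →
          ∃ i : RMultiMK Q Γ m2, i.P = P ∧ i.K = 2 ∧ i.T.lam 0 = Finset.univ ∧
            HEq (i.T.lam 1) (HiggsLattice.blockSet ({y₀} : Finset (HiggsLattice.Site P 2))) ∧ i.restrictedM ∧ i.field ≠ 0 := by
  obtain ⟨δ, C₁, C₂, hδ, hC₁, hC₂, pkg⟩ := exists_lemma23Bounds d L hd hL ha hΓ.μ0sq_pos Γ.ε₀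
  set κ : ℝ := kappaW a L Γ.μ0sq C₂ with hκ
  have hκ0 : 0 ≤ κ := kappaW_nonneg ha hL.2 hΓ.μ0sq_pos.le hC₂.le
  refine ⟨max 6 (2 / δ), min Γ.ε₀ (1 / (2 * (κ + 1))), lt_max_of_lt_left (by norm_num),
    lt_min hΓ.ε₀_pos (by positivity), min_le_left _ _, ?_⟩
  intro Q hQd hQL hQa hR hr m2 P S hPd hPL hK2 hs y₀ v hv1 hv2 hv0
  subst hQd hQL hQa
  have hR6 : 6 ≤ Q.R := le_trans (le_max_left _ _) hR
  have hRδ : 2 / δ ≤ Q.R := le_trans (le_max_right _ _) hR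
  have hε₀ : P.mesh 2 ≤ Γ.ε₀ := hs.trans (min_le_left _ _)
  have hsmall : kappaW Q.a Q.L Γ.μ0sq C₂ * P.mesh 2 < 1 := by
    rw [← hκ]
    have h1 : P.mesh 2 ≤ 1 / (2 * (κ + 1)) := hs.trans (min_le_right _ _)
    have h2 : κ * P.mesh 2 ≤ κ * (1 / (2 * (κ + 1))) := mul_le_mul_of_nonneg_left h1 hκ0
    have h3 : κ * (1 / (2 * (κ + 1))) < 1 := by
      rw [mul_one_div, div_lt_one (by positivity)]
      linarith
    linarith
  refine ⟨witness2 hΓ hR6 (by linarith) P S hPL hPd hK2 hε₀ y₀ v, rfl, rfl, rfl, HEq.rfl,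
    witness2_restrictedM hΓ hR6 (by linarith) P S hPL hPd hK2 hε₀ y₀ v hv1 hv2, ?_⟩
  exact witness2_field_ne_zero hΓ ha pkg hδ hC₂.le hR6 hRδ hr P S hPL hPd hK2 hε₀ hsmall y₀ hv0

end NonZero

end Literature.MathematicalPhysics.QuantumFieldTheory.Balaban1983to89.B2Prop31MinimizerWitness2

end
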